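import Summits.Ventures.YMGap.Thresholds.StarWindowBoundDim
import Summits.Ventures.YMGap.Thresholds.StarLimitDim
import Summits.Ventures.YMGap.Thresholds.QuarterModulusOneHalf
import Literature.MathematicalPhysics.QuantumFieldTheory.Balaban1983to89.StrongCouplingKernelWindow
import Summits.Ventures.YMGap.Thresholds.CouplingSignFlipMassGap
import Summits.Ventures.YMGap.Thresholds.SharpStrongCoupling
import Summits.Ventures.YMGap.StrongCouplingGapFromCertificate
import HarnessLib

/-!
# Venture YMGap — track (c) «DS» meets track (a) in EVERY DIMENSION `d`: `MassGapAt d N x` and the cell's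
# TARGET TYPE `ImprovedThreshold d N x₀` from the general-`d` star window — every `SU(N)`, `N ≥ 2`, `d ≥ 2`

HONEST FRAMING: venture file (cell `pub-ymgap`, QuantumFields programme; seat ds-1), strong-coupling LATTICE
statements for `SU(N)` lattice Yang–Mills on `ℤ^d` with the Wilson action (tree coupling `N·x`, 't Hooft
coupling `x`; `SU(2)`: Wilson `β_W = 4x`); nothing about the continuum, confinement at weak coupling, or the
Millennium problem.  The ROWS of the general-`d` star door in the currency of `Summit.Ventures.YMGap.MassGapAt`
(DLR uniqueness on `ℤ^d` + the Shen–Zhu–Zhu covariance clause for every DLR state): the window PRODUCER is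
ds-4's general-(`d`, `N`) Lemma G `StarLemmaGDimSUN.star_window_of_oneLinkKRModulus` (door polynomial
`P_d(c) = (4d−4)c² + (4d−6)c < 1`, received sum `R_G^{(d)}(c)`), the CONSUMER is this seat's any-`d` socket
`StarDimLimit.star_massGapAt_of_windows`; ds-4's sibling `StarDimRows` has the uniqueness / unique-limit / torus
clustering rows under the same hypotheses — here the `MassGapAt` / `ImprovedThreshold` currency, every `d` (this file
imports `StarWindowBoundDim` only, so the two rows files are independent).

OUTPUT, HYPOTHESIS-FREE:
* every `SU(N)`, `N ≥ 2`, every `d ≥ 2`, TWO-SIDED, CLOSED FORM: `massGapAt_SU_of_abs_le :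
  |x|·(d−1) ≤ 1/12 → MassGapAt d N x` and ★ `improvedThreshold_SU_dim : ImprovedThreshold d N (1/(12(d−1)))` —
  the cell's track-(a) TARGET TYPE in EVERY dimension for EVERY `N` (printed Shen–Zhu–Zhu `1/(16(d−1))`:
  `× 4/3` uniformly in `d`; Bakry–Émery modulus `oneLinkKRModulus_SU`, `K ≤ 3`, `P_d(3x) ≤ 1 − 3x`), and its
  EXACT form ★ `improvedThreshold_SU_dim_exact : ImprovedThreshold d N (1/(2(√(4d²−8d+5) + 4d − 5)))` — the largest
  window the Bakry–Émery modulus + vertex-star door give in dimension `d` (`d = 3`: `0.04495`, `d = 4`: `0.02927`,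
  `d = 5`: `0.02168`; the closed form `1/(12(d−1))` is its corollary);
  `d = 3` row `|x| ≤ 2/45` (`improvedThreshold_SU_three : ImprovedThreshold 3 N (2/45)`; `2/45 = 0.0444 >
  1/24 = 0.04167`, the sharp Bakry–Émery `1/(8d)` at `d = 3`); `d = 4`: the row of record stays `9/308`
  (`StarSUNLimit.improvedThreshold_SU_star`, `1/36 < 9/308`);
* `SU(2)`, every `d ≥ 2`, TWO-SIDED via ds-3's any-`d` sign flip (`SignFlip.massGapAt_two_neg`), EXACT
  THRESHOLD: ★ `su2_improvedThreshold_dim : ImprovedThreshold d 2 ((√(4d²−8d+5) − (2d−3))/(4(d−1)))`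
  ('t Hooft; Wilson `β⋆_G(d) = (√(4d²−8d+5) − (2d−3))/(d−1)`: `d = 3`: `0.5616`, `d = 5`: `0.2656`,
  `d = 6`: `0.2100`; quarter modulus `OneLinkKRModulus 2 (3/4) 1`); rational rows `ImprovedThreshold 3 2 (5/36)`,
  `ImprovedThreshold 5 2 (13/200)`, `ImprovedThreshold 6 2 (1/20)` (vs the sharp `1/24`, `1/40`, `1/48`:
  `× 10/3`, `× 13/5`, `× 12/5`); the `d = 4` value `ImprovedThreshold 4 2 (9/100)` is re-derived as an `example`
  only (row of record: the tree's `ImprovedThresholdStar.su2_improvedThreshold_9_100`).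
No rate is claimed beyond `∃ c > 0`; no transfer-matrix gap; `d = 2` rows are formal (the model is solvable).

References: Dobrushin–Shlosman (1985) `C_V`; Föllmer, LNM 1362 (1988) Ch. I; Shen–Zhu–Zhu, CMP 400 (2023)
Thm 1.2 / Cor 1.4 (the clause shape and the printed `1/(16(d−1))`); cell files STAR-DIMENSIONS(-K).md (ds-4).
-/

noncomputable section

open MeasureTheory ProbabilityTheory Function Finset
open scoped NNReal
open Literature.Probability.LatticeModels
open Literature.MathematicalPhysics.QuantumLattice (fundamentalRep ymSpecification HasUniqueInfiniteVolumeLimit)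
open Literature.MathematicalPhysics.QuantumFieldTheory
open Literature.MathematicalPhysics.QuantumFieldTheory.Balaban1983to89
open Literature.MathematicalPhysics.QuantumFieldTheory.Balaban1983to89.StrongCouplingDobrushinWindow
  (OneLinkKRModulus DLRMassGapAt)
open Literature.MathematicalPhysics.QuantumFieldTheory.Balaban1983to89.StrongCouplingTorusWindow
open Literature.MathematicalPhysics.QuantumFieldTheory.Balaban1983to89.StrongCouplingKernelWindow
  (oneLinkKRModulus_SU)
open Summit.Ventures.YMGap.DSWindow
open Summit.Ventures.YMGap.StarResolventDim
open Summit.Ventures.YMGap.StarLemmaGDim (Karr)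
open Summit.Ventures.YMGap.StarLemmaGDimSUN (star_window_of_oneLinkKRModulus)
open Summit.Ventures.YMGap.StarDimLimit (star_massGapAt_of_windows)
open Summit.Ventures.YMGap.SignFlip (massGapAt_two_neg improvedThreshold_two_of_nonneg)

namespace Summit.Ventures.YMGap.StarDimMassGap

variable {d N : ℕ}

/-! ### The socket-fed row: `MassGapAt d N x` from ANY one-link modulus, dimension `d` -/

/-- **`MassGapAt d N x` from a one-link modulus, dimension `d`** (`SU(N)`, `N ≥ 1`, `d ≥ 2`, 't Hooft `x`,
tree coupling `N·x`): `OneLinkKRModulus N R K` with `K ≥ 0` on the tilt ball `R ≥ 2(d−1)|x|` and the door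
`P_d(K|x|) < 1` gives the four star-window clauses on every torus of side `≥ 3` with received sum
`R_G^{(d)}(K|x|) < 1` (ds-4's `StarLemmaGDimSUN.star_window_of_oneLinkKRModulus`), hence — through this seat's
socket `StarDimLimit.star_massGapAt_of_windows` (uniqueness on `ℤ^d` via the side-`5` chart + the Shen–Zhu–Zhu
covariance clause for the limit states) — `MassGapAt d N x`. [folklore] -/
theorem massGapAt_of_oneLinkKRModulus (hd : 2 ≤ d) (hN : 1 ≤ N) {x R K : ℝ} (hK0 : 0 ≤ K)
    (hR : |x| * (2 * ((d : ℝ) - 1)) ≤ R) (hmod : OneLinkKRModulus N R K)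
    (h : doorPoly d (K * |x|) < 1) : MassGapAt d N x := by
  have hN0 : (0 : ℝ) < N := by exact_mod_cast (show 0 < N by omega)
  have ex : |(N : ℝ) * x| / N = |x| := by
    rw [abs_mul, abs_of_pos hN0, mul_div_cancel_left₀ _ hN0.ne']
  have hR' : |(N : ℝ) * x| / N * (2 * ((d : ℝ) - 1)) ≤ R := by rw [ex]; exact hR
  have h' : doorPoly d (K * (|(N : ℝ) * x| / N)) < 1 := by rw [ex]; exact h
  have hc0 : 0 ≤ K * |x| := mul_nonneg hK0 (abs_nonneg x)
  obtain ⟨hρ0, hρ1⟩ := gaugeR_lt_one_of_door hd hc0 h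
  refine star_massGapAt_of_windows x hρ0 hρ1 3 (fun L _ hL => ?_)
  obtain ⟨hK, hKloc, hH1, hH2⟩ := star_window_of_oneLinkKRModulus (L := L) hd hL hN hK0 hR' hmod h'
  refine ⟨_, hK, hKloc, hH1, fun s e he => ?_⟩
  rw [hH2 s e he, ex]

/-! ### Every `SU(N)`, `N ≥ 2`, every `d ≥ 2`: the hypothesis-free Bakry–Émery modulus -/

/-- **`SU(N)`, `N ≥ 2`, dimension `d ≥ 2`, two-sided**: with `2(d−1)|x| < 1/2` and the door at the Bakry–Émery
coefficient `c = |x|/(1/2 − 2(d−1)|x|)`, `MassGapAt d N x` (`oneLinkKRModulus_SU`, `K = 1/(1/2 − R)` at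
`R = 2(d−1)|x|`). [folklore] -/
theorem massGapAt_SU_of_door (hd : 2 ≤ d) (hN : 2 ≤ N) {x : ℝ} (hx : |x| * (2 * ((d : ℝ) - 1)) < 1 / 2)
    (h : doorPoly d (1 / (1 / 2 - |x| * (2 * ((d : ℝ) - 1))) * |x|) < 1) : MassGapAt d N x := by
  have hK0 : 0 ≤ 1 / (1 / 2 - |x| * (2 * ((d : ℝ) - 1))) := by
    have : 0 < 1 / 2 - |x| * (2 * ((d : ℝ) - 1)) := by linarith
    positivity
  exact massGapAt_of_oneLinkKRModulus hd (by omega) hK0 le_rfl (oneLinkKRModulus_SU hN hx) h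

/-- **`SU(N)`, EVERY `N ≥ 2`, EVERY `d ≥ 2`, CLOSED FORM, HYPOTHESIS-FREE, TWO-SIDED**: at every 't Hooft
coupling with `(d−1)|x| ≤ 1/12` the `SU(N)` lattice Yang–Mills specification on `ℤ^d` at tree coupling `N·x` has
exactly one DLR state AND the Shen–Zhu–Zhu covariance clause holds for it — `MassGapAt d N x`.  Arithmetic (as in
ds-4's `StarDimRows.unique_SU_of_abs_le`): `K = 1/(1/2 − 2(d−1)|x|) ≤ 3`, so `c ≤ 3|x|`, and
`P_d(3|x|) = 36(d−1)x² + (12d−18)|x| ≤ 1 − 3|x| < 1`.  Printed single-site window: `1/(16(d−1))`. [folklore] -/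
theorem massGapAt_SU_of_abs_le (hd : 2 ≤ d) (hN : 2 ≤ N) {x : ℝ} (h : |x| * ((d : ℝ) - 1) ≤ 1 / 12) :
    MassGapAt d N x := by
  have hd' : (2 : ℝ) ≤ d := by exact_mod_cast hd
  have hx0 : 0 ≤ |x| := abs_nonneg x
  have hu : |x| * (2 * ((d : ℝ) - 1)) ≤ 1 / 6 := by nlinarith
  have hx : |x| * (2 * ((d : ℝ) - 1)) < 1 / 2 := by linarith
  refine massGapAt_SU_of_door hd hN hx ?_
  have hpos' : (0 : ℝ) < 1 / 2 - |x| * (2 * ((d : ℝ) - 1)) := by linarith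
  have hK3 : 1 / (1 / 2 - |x| * (2 * ((d : ℝ) - 1))) ≤ 3 := by
    rw [div_le_iff₀ hpos']; linarith
  have hc0 : 0 ≤ 1 / (1 / 2 - |x| * (2 * ((d : ℝ) - 1))) * |x| := mul_nonneg (one_div_pos.2 hpos').le hx0
  have hcle : 1 / (1 / 2 - |x| * (2 * ((d : ℝ) - 1))) * |x| ≤ 3 * |x| := mul_le_mul_of_nonneg_right hK3 hx0
  refine doorPoly_lt_one_mono hd hc0 hcle ?_
  unfold doorPoly
  set y := |x| with hydef
  have h36 : 36 * ((d : ℝ) - 1) * y ^ 2 ≤ 3 * y := by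
    have : 36 * ((d : ℝ) - 1) * y ^ 2 = 36 * y * (y * ((d : ℝ) - 1)) := by ring
    rw [this]
    nlinarith
  have h12 : (12 * (d : ℝ) - 18) * y ≤ 1 - 6 * y := by nlinarith
  rcases eq_or_lt_of_le hx0 with hzero | hpos
  · rw [← hzero]; norm_num
  · nlinarith

/-- **THE CELL'S TRACK-(a) TARGET TYPE IN EVERY DIMENSION, FOR EVERY `SU(N)`, HYPOTHESIS-FREE:
`ImprovedThreshold d N (1/(12(d−1)))`, `d ≥ 2`, `N ≥ 2`** — `1/(16(d−1)) < 1/(12(d−1))` (× `4/3` beyond the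
printed Shen–Zhu–Zhu window, uniformly in `d`) and `MassGapBelow d N (1/(12(d−1)))`: DLR uniqueness and
exponential clustering of Lipschitz cylinder covariances for every DLR state at every 't Hooft `|x| < 1/(12(d−1))`.
(`d = 4`: the optimised row of record `9/308 > 1/36` is `StarSUNLimit.improvedThreshold_SU_star`; `d = 3`: the
optimised `2/45 > 1/24` is `improvedThreshold_SU_three`; the cell's sharp Bakry–Émery target `1/(8d)` coincides
with `1/(12(d−1))` exactly at `d = 3` and is larger for `d ≥ 4`.)  Lattice strong-coupling statement; no rate
beyond `∃ c > 0`; nothing about the continuum. [folklore] -/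
theorem improvedThreshold_SU_dim (hd : 2 ≤ d) (hN : 2 ≤ N) : ImprovedThreshold d N (1 / (12 * ((d : ℝ) - 1))) := by
  have hd' : (2 : ℝ) ≤ d := by exact_mod_cast hd
  have hd1 : (0 : ℝ) < (d : ℝ) - 1 := by linarith
  refine ⟨one_div_lt_one_div_of_lt (by positivity) (by linarith), fun x hx => massGapAt_SU_of_abs_le hd hN ?_⟩
  rw [lt_div_iff₀ (by positivity)] at hx
  linarith

/-- The SC-a Literature currency: **`DLRMassGapAt d N x` for every `N ≥ 2`, `d ≥ 2`, `(d−1)|x| ≤ 1/12`**,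
hypothesis-free (dictionary `massGapAt_iff_dlrMassGapAt`; the tree's printed all-`N` row is `dlrMassGapAt_SU`,
`|x| < 1/(16(d−1))`). [folklore] -/
theorem dlrMassGapAt_SU_of_abs_le (hd : 2 ≤ d) (hN : 2 ≤ N) {x : ℝ} (h : |x| * ((d : ℝ) - 1) ≤ 1 / 12) :
    DLRMassGapAt d N x :=
  massGapAt_iff_dlrMassGapAt.1 (massGapAt_SU_of_abs_le hd hN h)

/-- **The strong-coupling phase predicate `HessianSharp.StrongCouplingPhaseAt d N β`** (convergence of the
periodic states along the full sequence of sides to a translation-invariant state, every infinite-volume limit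
equal to it, exponential plaquette clustering) for every `N ≥ 2`, `d ≥ 2` at tree coupling `(d−1)|β|/N ≤ 1/12`,
hypothesis-free — `massGapAt_SU_of_abs_le` through p2's bridge `strongCouplingPhaseAt_of_massGapAt`. [folklore] -/
theorem strongCouplingPhaseAt_SU_of_abs_le (hd : 2 ≤ d) (hN : 2 ≤ N) {β : ℝ}
    (h : |β| / N * ((d : ℝ) - 1) ≤ 1 / 12) : HessianSharp.StrongCouplingPhaseAt d N β := by
  have hN0 : (0 : ℝ) < N := by exact_mod_cast (show 0 < N by omega)
  refine HessianSharp.strongCouplingPhaseAt_of_massGapAt hN hd (massGapAt_SU_of_abs_le hd hN ?_)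
  rwa [abs_div, abs_of_pos hN0]

/-- **`SU(N)`, `N ≥ 2`, `d = 3` row**: `MassGapAt 3 N x` at every 't Hooft `|x| ≤ 2/45 = 0.0444…`, hypothesis-free
(at `|x| = 2/45` the Bakry–Émery coefficient is `c = 4/29` and `8c² + 6c = 824/841 < 1`; printed `1/32`; the cell's
sharp Bakry–Émery `1/(8d) = 1/24 = 0.04167 < 2/45`). [folklore] -/
theorem massGapAt_SU_three_of_abs_le (hN : 2 ≤ N) {x : ℝ} (h : |x| ≤ 2 / 45) : MassGapAt 3 N x := by
  have hx0 : 0 ≤ |x| := abs_nonneg x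
  have hx : |x| * (2 * (((3 : ℕ) : ℝ) - 1)) < 1 / 2 := by push_cast; linarith
  refine massGapAt_SU_of_door (d := 3) (by norm_num) hN hx ?_
  have hpos : 0 < 1 / 2 - |x| * (2 * (((3 : ℕ) : ℝ) - 1)) := by linarith
  have hc0 : 0 ≤ 1 / (1 / 2 - |x| * (2 * (((3 : ℕ) : ℝ) - 1))) * |x| := mul_nonneg (one_div_pos.2 hpos).le hx0
  have hcle : 1 / (1 / 2 - |x| * (2 * (((3 : ℕ) : ℝ) - 1))) * |x| ≤ 4 / 29 := by
    rw [one_div_mul_eq_div, div_le_iff₀ hpos]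
    push_cast
    linarith
  refine doorPoly_lt_one_mono (by norm_num) hc0 hcle ?_
  unfold doorPoly; norm_num

/-- **`ImprovedThreshold 3 N (2/45)` for every `N ≥ 2`, hypothesis-free** (`1/32 < 2/45`; beyond both the printed
`1/32` and the sharp Bakry–Émery `1/24` at `d = 3`). [folklore] -/
theorem improvedThreshold_SU_three (hN : 2 ≤ N) : ImprovedThreshold 3 N (2 / 45) :=
  ⟨by norm_num, fun _ hx => massGapAt_SU_three_of_abs_le hN hx.le⟩

/-- **The EXACT threshold of the Bakry–Émery + star method, every `SU(N)`, `N ≥ 2`, every `d ≥ 2`, two-sided**: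
`MassGapAt d N x` at every 't Hooft `|x| < x⋆(d) = 1/(2(√(4d²−8d+5) + 4d − 5))` (`d = 3`: `0.04495`; `d = 4`: `0.02927`,
the true door behind the booked `9/308 = 0.02922`; `d = 5`: `0.02168`).  Algebra: the Bakry–Émery coefficient
`c(x) = |x|/(1/2 − 2(d−1)|x|)` is below the door root `c⋆(d) = (√(4d²−8d+5) − (2d−3))/(4(d−1))` iff
`|x|·(√(4d²−8d+5) + 4d − 5) < 1/2`, by `(√D − 2d + 3)(√D + 2d − 3) = 4(d−1)`. [folklore] -/
theorem massGapAt_SU_of_lt_exact (hd : 2 ≤ d) (hN : 2 ≤ N) {x : ℝ}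
    (hx : |x| < 1 / (2 * (Real.sqrt (4 * (d : ℝ) ^ 2 - 8 * d + 5) + 4 * (d : ℝ) - 5))) : MassGapAt d N x := by
  have hd' : (2 : ℝ) ≤ d := by exact_mod_cast hd
  set s : ℝ := Real.sqrt (4 * (d : ℝ) ^ 2 - 8 * d + 5) with hsdef
  have hD : (0 : ℝ) ≤ 4 * (d : ℝ) ^ 2 - 8 * d + 5 := by nlinarith
  have hs0 : 0 ≤ s := Real.sqrt_nonneg _
  have hs2 : s ^ 2 = 4 * (d : ℝ) ^ 2 - 8 * d + 5 := Real.sq_sqrt hD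
  -- `s > 2d − 3` since `s² = (2d−3)² + 4(d−1)`
  have hs3 : 2 * (d : ℝ) - 3 < s := by nlinarith
  have key : (s - 2 * (d : ℝ) + 3) * (s + 2 * (d : ℝ) - 3) = 4 * ((d : ℝ) - 1) := by nlinarith
  have hT : 0 < 2 * (s + 4 * (d : ℝ) - 5) := by nlinarith
  have hy0 : 0 ≤ |x| := abs_nonneg x
  have hy : |x| * (2 * (s + 4 * (d : ℝ) - 5)) < 1 := by rwa [lt_div_iff₀ hT] at hx
  -- (i) the tilt radius is inside the Bakry–Émery ball
  have hx' : |x| * (2 * ((d : ℝ) - 1)) < 1 / 2 := by nlinarith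
  refine massGapAt_SU_of_door hd hN hx' ?_
  -- (ii) the door, through the exact root
  have hpos : (0 : ℝ) < 1 / 2 - |x| * (2 * ((d : ℝ) - 1)) := by linarith
  have hc0 : 0 ≤ 1 / (1 / 2 - |x| * (2 * ((d : ℝ) - 1))) * |x| := mul_nonneg (one_div_pos.2 hpos).le hy0
  refine (doorCond_iff_lt_sqrt hd hc0).2 ?_
  have h4 : (0 : ℝ) < 4 * ((d : ℝ) - 1) := by linarith
  rw [← hsdef, one_div_mul_eq_div, div_lt_div_iff₀ hpos h4]
  have hy' : |x| * (s + 4 * (d : ℝ) - 5) < 1 / 2 := by linarith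
  have hsp : 0 < s - 2 * (d : ℝ) + 3 := by linarith
  nlinarith [mul_lt_mul_of_pos_left hy' hsp, key, hy0]

/-- **THE EXACT ALL-`N` COLUMN: `ImprovedThreshold d N (1/(2(√(4d²−8d+5) + 4d − 5)))` for every `d ≥ 2`, `N ≥ 2`,
hypothesis-free** — the largest 't Hooft window the Bakry–Émery one-link modulus and the vertex-star door give in
dimension `d` (`> 1/(12(d−1))`, the closed-form row; `> 1/(16(d−1))`, print, since `√(4d²−8d+5) < 4d − 3`).
[folklore] -/
theorem improvedThreshold_SU_dim_exact (hd : 2 ≤ d) (hN : 2 ≤ N) :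
    ImprovedThreshold d N (1 / (2 * (Real.sqrt (4 * (d : ℝ) ^ 2 - 8 * d + 5) + 4 * (d : ℝ) - 5))) := by
  have hd' : (2 : ℝ) ≤ d := by exact_mod_cast hd
  refine ⟨?_, fun x hx => massGapAt_SU_of_lt_exact hd hN hx⟩
  have hD : (0 : ℝ) ≤ 4 * (d : ℝ) ^ 2 - 8 * d + 5 := by nlinarith
  have hs : Real.sqrt (4 * (d : ℝ) ^ 2 - 8 * d + 5) < 4 * (d : ℝ) - 3 := by
    rw [Real.sqrt_lt' (by linarith)]
    nlinarith
  have hs0 : 0 ≤ Real.sqrt (4 * (d : ℝ) ^ 2 - 8 * d + 5) := Real.sqrt_nonneg _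
  exact one_div_lt_one_div_of_lt (by nlinarith) (by nlinarith)

/-! ### `SU(2)` in dimension `d`: the quarter modulus, exact threshold `β⋆_G(d)`, two-sided by the sign flip -/

/-- **`SU(2)`, dimension `d ≥ 2`: `MassGapAt d 2 (β_W/4)` at every Wilson `0 ≤ β_W` below the door**
(`P_d(β_W/4) < 1`, i.e. `β_W < β⋆_G(d)`; tree coupling `β_W/2`): the quarter modulus `OneLinkKRModulus 2 (3/4) 1`
(the door already forces the tilt `(d−1)β_W/2 ≤ 3/4`, ds-4's observation in `StarDimRows.su2_inputs`) in the
socket-fed row. [folklore] -/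
theorem su2_massGapAt_of_door (hd : 2 ≤ d) {βW : ℝ} (h0 : 0 ≤ βW) (h : doorPoly d (βW / 4) < 1) :
    MassGapAt d 2 (βW / 4) := by
  have hd' : (2 : ℝ) ≤ d := by exact_mod_cast hd
  -- the quarter modulus on the tilt ball `3/4` (`QuarterModulusOneHalf` at `β_W = 1/2`)
  have hmod : OneLinkKRModulus 2 (3 / 4) 1 := by
    have hm := Summit.Ventures.YMGap.QuarterModulusOneHalf.oneLinkKRModulusSU2_of_le_oneHalf
      (βW := 1 / 2) le_rfl
    unfold Balaban1983to89.StrongCouplingDobrushinWindow.OneLinkKRModulusSU2 at hm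
    norm_num at hm
    exact hm
  have habs : |βW / 4| = βW / 4 := abs_of_nonneg (by linarith)
  -- the door bounds the tilt: `(β_W/4)(d−1) ≤ 3/8` (as in ds-4's `StarDimRows.tilt_le_of_door`)
  have htilt : βW / 4 * ((d : ℝ) - 1) ≤ 3 / 8 := by
    unfold doorPoly at h
    by_contra hneg
    have hneg : 3 / 8 < βW / 4 * ((d : ℝ) - 1) := lt_of_not_ge hneg
    have h1 : (4 * (d : ℝ) - 4) * (βW / 4) ^ 2 ≥ 3 / 2 * (βW / 4) := by nlinarith
    have h2 : (4 * (d : ℝ) - 9 / 2) * (βW / 4) < 1 := by nlinarith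
    nlinarith
  refine massGapAt_of_oneLinkKRModulus hd (by norm_num) zero_le_one (R := 3 / 4) ?_ hmod ?_
  · rw [habs]; nlinarith
  · rw [habs, one_mul]; exact h

/-- **`SU(2)`, dimension `d ≥ 2`, 't Hooft units, EXACT THRESHOLD, one-sided**: `MassGapAt d 2 x` at every
`0 ≤ x < c⋆(d) = (√(4d²−8d+5) − (2d−3))/(4(d−1))` (`StarResolventDim.doorCond_iff_lt_sqrt`). [folklore] -/
theorem su2_massGapAt_of_lt (hd : 2 ≤ d) {x : ℝ} (h0 : 0 ≤ x)
    (h : x < (Real.sqrt (4 * (d : ℝ) ^ 2 - 8 * d + 5) - (2 * (d : ℝ) - 3)) / (4 * ((d : ℝ) - 1))) :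
    MassGapAt d 2 x := by
  have e : 4 * x / 4 = x := by ring
  have h1 := su2_massGapAt_of_door hd (βW := 4 * x) (by linarith) (by rw [e]; exact (doorCond_iff_lt_sqrt hd h0).2 h)
  rwa [e] at h1

/-- The threshold exceeds the printed window: `1/(16(d−1)) < c⋆(d) = (√(4d²−8d+5) − (2d−3))/(4(d−1))` for every
`d ≥ 2` (equivalently `2d − 11/4 < √(4d²−8d+5)`, and `(2d − 11/4)² = 4d² − 11d + 121/16 < 4d² − 8d + 5`).
[folklore] -/
theorem szz_lt_threshold (hd : 2 ≤ d) :
    1 / (16 * ((d : ℝ) - 1)) <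
      (Real.sqrt (4 * (d : ℝ) ^ 2 - 8 * d + 5) - (2 * (d : ℝ) - 3)) / (4 * ((d : ℝ) - 1)) := by
  have hd' : (2 : ℝ) ≤ d := by exact_mod_cast hd
  have h4 : (0 : ℝ) < 4 * ((d : ℝ) - 1) := by linarith
  have hsq : 2 * (d : ℝ) - 11 / 4 < Real.sqrt (4 * (d : ℝ) ^ 2 - 8 * d + 5) := by
    refine Real.lt_sqrt_of_sq_lt ?_
    nlinarith
  have hd1 : (d : ℝ) - 1 ≠ 0 := by linarith
  have e : 1 / (16 * ((d : ℝ) - 1)) * (4 * ((d : ℝ) - 1)) = 1 / 4 := by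
    rw [one_div_mul_eq_div, div_eq_iff (mul_ne_zero (by norm_num) hd1)]
    ring
  rw [lt_div_iff₀ h4, e]
  linarith

/-- **`SU(2)`, EVERY `d ≥ 2`, EXACT THRESHOLD, TWO-SIDED, HYPOTHESIS-FREE: `ImprovedThreshold d 2 c⋆(d)`**,
`c⋆(d) = (√(4d²−8d+5) − (2d−3))/(4(d−1))` ('t Hooft; Wilson `β⋆_G(d) = 4c⋆(d)`: `d = 3`: `(√17−3)/2 = 0.5616`,
`d = 4`: `(√37−5)/3 = 0.3609`, `d = 5`: `(√65−7)/4 = 0.2656`, `d = 6`: `(√101−9)/5 = 0.2100`): `MassGapAt d 2 x`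
at every `|x| < c⋆(d)` — the negative side by ds-3's any-`d` coupling-sign flip `SignFlip.massGapAt_two_neg`.
[folklore] -/
theorem su2_improvedThreshold_dim (hd : 2 ≤ d) :
    ImprovedThreshold d 2
      ((Real.sqrt (4 * (d : ℝ) ^ 2 - 8 * d + 5) - (2 * (d : ℝ) - 3)) / (4 * ((d : ℝ) - 1))) := by
  refine ⟨szz_lt_threshold hd, fun x hx => ?_⟩
  rcases le_or_gt 0 x with h0 | h0
  · exact su2_massGapAt_of_lt hd h0 (abs_lt.1 hx).2
  · have h1 : MassGapAt d 2 (-x) := su2_massGapAt_of_lt hd (by linarith) (by linarith [(abs_lt.1 hx).1])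
    simpa using massGapAt_two_neg (d := d) h1

/-! ### `SU(2)` rows at rational couplings: `d = 3, 5, 6` (and the `d = 4` re-derivation) -/

/-- **`d = 3`**: `MassGapAt 3 2 (β_W/4)` at every Wilson `0 ≤ β_W ≤ 5/9` (`R_G^{(3)}(5/36) = 205/209`;
single-site door `1/3`). [folklore] -/
theorem su2_three_massGapAt_le {βW : ℝ} (h0 : 0 ≤ βW) (h : βW ≤ 5 / 9) : MassGapAt 3 2 (βW / 4) :=
  su2_massGapAt_of_door (d := 3) (by norm_num) h0
    (doorPoly_lt_one_mono (by norm_num) (by linarith) (by linarith : βW / 4 ≤ 5 / 36) doorPoly_rows.1)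

/-- **`ImprovedThreshold 3 2 (5/36)`** — `SU(2)` on `ℤ³`, two-sided, hypothesis-free ('t Hooft `5/36 = 0.1389`
vs the printed `1/32` and the sharp Bakry–Émery `1/24`: `× 40/9` and `× 10/3`). [folklore] -/
theorem su2_three_improvedThreshold : ImprovedThreshold 3 2 (5 / 36) :=
  improvedThreshold_two_of_nonneg (by norm_num) fun x h0 hx => by
    have e : 4 * x / 4 = x := by ring
    have h1 := su2_three_massGapAt_le (βW := 4 * x) (by linarith) (by linarith)
    rwa [e] at h1

/-- **`d = 5`**: `MassGapAt 5 2 (β_W/4)` at every Wilson `0 ≤ β_W ≤ 13/50` (`R_G^{(5)}(13/200) = 2769/2881`;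
single-site door `1/6`). [folklore] -/
theorem su2_five_massGapAt_le {βW : ℝ} (h0 : 0 ≤ βW) (h : βW ≤ 13 / 50) : MassGapAt 5 2 (βW / 4) :=
  su2_massGapAt_of_door (d := 5) (by norm_num) h0
    (doorPoly_lt_one_mono (by norm_num) (by linarith) (by linarith : βW / 4 ≤ 13 / 200) doorPoly_rows.2.1)

/-- **`ImprovedThreshold 5 2 (13/200)`** — `SU(2)` on `ℤ⁵`, two-sided, hypothesis-free ('t Hooft `0.065` vs the
printed `1/64` and the sharp `1/40`: `× 4.16` and `× 13/5`). [folklore] -/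
theorem su2_five_improvedThreshold : ImprovedThreshold 5 2 (13 / 200) :=
  improvedThreshold_two_of_nonneg (by norm_num) fun x h0 hx => by
    have e : 4 * x / 4 = x := by ring
    have h1 := su2_five_massGapAt_le (βW := 4 * x) (by linarith) (by linarith)
    rwa [e] at h1

/-- **`d = 6`**: `MassGapAt 6 2 (β_W/4)` at every Wilson `0 ≤ β_W ≤ 1/5` (`R_G^{(6)}(1/20) = 21/23`; single-site
door `2/15`). [folklore] -/
theorem su2_six_massGapAt_le {βW : ℝ} (h0 : 0 ≤ βW) (h : βW ≤ 1 / 5) : MassGapAt 6 2 (βW / 4) :=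
  su2_massGapAt_of_door (d := 6) (by norm_num) h0
    (doorPoly_lt_one_mono (by norm_num) (by linarith) (by linarith : βW / 4 ≤ 1 / 20) doorPoly_rows.2.2.1)

/-- **`ImprovedThreshold 6 2 (1/20)`** — `SU(2)` on `ℤ⁶`, two-sided, hypothesis-free ('t Hooft `0.05` vs the
printed `1/80` and the sharp `1/48`: `× 4` and `× 12/5`). [folklore] -/
theorem su2_six_improvedThreshold : ImprovedThreshold 6 2 (1 / 20) :=
  improvedThreshold_two_of_nonneg (by norm_num) fun x h0 hx => by
    have e : 4 * x / 4 = x := by ring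
    have h1 := su2_six_massGapAt_le (βW := 4 * x) (by linarith) (by linarith)
    rwa [e] at h1

/- **`d = 4` re-derivation through the general-`d` chain** (consistency check ONLY, an `example`: the row of
record `ImprovedThreshold 4 2 (9/100)` is the tree's `ImprovedThresholdStar.su2_improvedThreshold_9_100`, not
re-declared here). -/
example : ImprovedThreshold 4 2 (9 / 100) :=
  improvedThreshold_two_of_nonneg (by norm_num) fun x h0 hx => by
    have e : 4 * x / 4 = x := by ring
    have hdoor : doorPoly 4 (9 / 100) < 1 := by unfold doorPoly; norm_num
    have h1 := su2_massGapAt_of_door (d := 4) (βW := 4 * x) (by norm_num) (by linarith)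
      (doorPoly_lt_one_mono (by norm_num) (by linarith : 0 ≤ 4 * x / 4) (by linarith : 4 * x / 4 ≤ 9 / 100)
        hdoor)
    rwa [e] at h1

/-- The thresholds side by side ('t Hooft units): all `N`: `1/(16(d−1))` (printed) `< 1/(12(d−1))` (this file,
`× 4/3`); `d = 3`: `1/32 < 1/24 ≤ 1/24 < 2/45`; `SU(2)`: `5/36 > 1/24` (`d = 3`), `13/200 > 1/40` (`d = 5`),
`1/20 > 1/48` (`d = 6`). [folklore] -/
theorem threshold_numbers :
    (1 : ℝ) / 32 < 2 / 45 ∧ (1 : ℝ) / 24 < 2 / 45 ∧ (1 : ℝ) / 24 < 5 / 36 ∧ (1 : ℝ) / 40 < 13 / 200 ∧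
      (1 : ℝ) / 48 < 1 / 20 ∧ (1 : ℝ) / 36 < 9 / 308 := by
  norm_num

end Summit.Ventures.YMGap.StarDimMassGap

end
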